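import Summits.Ventures.QEC.Census.BB.A1s_n192_k8_a80d8cc5.WitA
import Summits.Ventures.QEC.Census.BB.A1s_n192_k4_0fa3ae82.Wit
import HarnessLib

set_option Elab.async false
set_option maxRecDepth 200000

/-!
# `[[192,8,16]]` one-level cover certificate of `A1s_n192_k8_a80d8cc5` — WITNESS TABLE of the level-1 list: the kernel-generated orbit table `orbTab eTr eInv 48 eReps`
# is a valid witness table (`witnessOK`) — qec-type-10's round-trip check `orbCheck` assembled from the 2 chunk verdicts of `WitA`
(`orbCheckAux_append` imported from the [[192,4,18]] chain's `Wit` p545098) and `CertCoverBatch.witnessOK_of_orbCheck`; the 48 downstairs tables `ePermqs` are permutation tables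
(`permListOK`). qec-search-1 g5 (pattern of search-9 g5 `Wit` p545098). Theorems only; KERNEL.
-/

namespace Summit.Ventures.QEC.Census.A1s_n192_k8_a80d8cc5

open Matrix Summit.Ventures.QEC.Census Literature.InformationTheory.QuantumCodes

set_option maxHeartbeats 400000000 in
/-- The chunks are `eReps`. -/
theorem repsC_eq : A1s_n192_k8_a80d8cc5.repsC0 ++ repsC1 = eReps := by decide +kernel

/-- **The round trip of the whole orbit table.** -/
theorem eOrb_check : orbCheck A1s_n192_k8_a80d8cc5.ePermqs eTr eInv 48 eReps = true := by
  rw [← repsC_eq]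
  simp only [orbCheck, A1s_n192_k4_0fa3ae82.orbCheckAux_append, Bool.and_eq_true]
  exact ⟨orbChk0, orbChk1⟩

set_option maxHeartbeats 400000000 in
/-- The 48 downstairs tables are permutation tables of the 96 qubits. -/
theorem ePermqs_ok : ∀ i : ℕ, i < A1s_n192_k8_a80d8cc5.ePermqs.length → permListOK 96 (ePermqs.getD i []) = true := by
  have h : ((List.range 48).all fun i => permListOK 96 (ePermqs.getD i [])) = true := by decide +kernel
  have hl : ePermqs.length = 48 := by decide
  intro i hi
  rw [hl] at hi
  simp only [List.all_eq_true, List.mem_range] at h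
  exact h i hi

/-- ★ **`wit_ok`**: the generated orbit table is a valid witness table for `eReps` over `ePermqs`. -/
theorem wit_ok : witnessOK 96 A1s_n192_k8_a80d8cc5.ePermqs eReps (orbTab eTr eInv 48 eReps) = true := witnessOK_of_orbCheck ePermqs_ok eOrb_check

/-- `hcw`: the orbit word list is covered by its own table. -/
theorem hcw : coveredOK A1s_n192_k8_a80d8cc5.eOrb (orbTab eTr eInv 48 eReps) = true := coveredOK_orbWords eReps

end Summit.Ventures.QEC.Census.A1s_n192_k8_a80d8cc5
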